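import Literature.Analysis.FluidPDE.AcceleratedRelaxationEnhancingFlows
import HarnessLib

/-!
# Rowan (2024), accelerated relaxation-enhancing flows — proved bookkeeping

Companion of `AcceleratedRelaxationEnhancingFlows.lean` (K. Rowan, *Accelerated relaxation enhancing
flows cause total dissipation*, Nonlinearity 37 (2024) 095010 = arXiv:2401.15001 [cite: Rowan2024]):
theorems only, no new facts.

* `Rowan2024.isAcceleration_div_one_sub`: the model acceleration `σ(t) = t/(1-t)` is a smooth
  increasing diffeomorphism `[0,1) → [0,∞)` in the sense of `Rowan2024.IsAcceleration` (non-vacuity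
  of the five clauses: `σ(0) = 0`, strictly increasing, `σ ↑ ∞` at `1⁻`, `C^∞` on `[0,1)`, `σ' > 0`).
* small API: `IsAcceleration.continuousOn`, `IsAcceleration.nonneg`, `accelerate_zero_flow`.
-/

noncomputable section

namespace Literature.Analysis.FluidPDE

open _root_.MeasureTheory _root_.Set _root_.Filter
open scoped NNReal ENNReal Topology ContDiff

namespace Rowan2024

variable {d : Type*} [Fintype d]

omit [Fintype d] in
/-- Accelerating the zero flow gives the zero flow. [cite: Rowan2024, Def. 1.5 p. 2] -/
theorem accelerate_zero_flow (σ : ℝ → ℝ) :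
    accelerate σ (fun _ _ => (0 : EuclideanSpace ℝ d)) = fun _ _ => 0 := by
  funext t x
  simp [accelerate]

/-- An acceleration is continuous on `[0,1)`. [cite: Rowan2024, Def. 1.5 p. 2] -/
theorem IsAcceleration.continuousOn {σ : ℝ → ℝ} (h : IsAcceleration σ) :
    ContinuousOn σ (Ico 0 1) :=
  h.2.2.2.1.continuousOn

/-- An acceleration is nonnegative on `[0,1)` (`σ(0) = 0` and `σ` increases). [cite: Rowan2024, Def. 1.5 p. 2] -/
theorem IsAcceleration.nonneg {σ : ℝ → ℝ} (h : IsAcceleration σ) {t : ℝ} (ht : t ∈ Ico (0 : ℝ) 1) :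
    0 ≤ σ t := by
  rcases eq_or_lt_of_le ht.1 with h0 | h0
  · rw [← h0, h.1]
  · have := h.2.1 (show (0 : ℝ) ∈ Ico (0 : ℝ) 1 from ⟨le_rfl, zero_lt_one⟩) ht h0
    rw [h.1] at this
    exact this.le

/-- The derivative of the model acceleration: `(t/(1-t))' = 1/(1-t)²` for `t ≠ 1`. [cite: Rowan2024, Def. 1.5 p. 2] -/
theorem hasDerivAt_div_one_sub {t : ℝ} (ht : t ≠ 1) :
    HasDerivAt (fun s : ℝ => s / (1 - s)) (1 / (1 - t) ^ 2) t := by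
  have h1 : (1 : ℝ) - t ≠ 0 := sub_ne_zero.2 (Ne.symm ht)
  have hnum : HasDerivAt (fun s : ℝ => s) 1 t := hasDerivAt_id t
  have hden : HasDerivAt (fun s : ℝ => 1 - s) (-1) t := (hasDerivAt_id t).const_sub 1
  have h := hnum.div hden h1
  rw [show (1 : ℝ) / (1 - t) ^ 2 = (1 * (1 - t) - t * -1) / (1 - t) ^ 2 by ring]
  exact h

/-- **Non-vacuity of `IsAcceleration`**: `σ(t) = t/(1-t)` is a smooth increasing diffeomorphism of
`[0,1)` onto `[0,∞)` in the typed sense. [cite: Rowan2024, Def. 1.5 and Thm. 1.6 p. 2] -/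
theorem isAcceleration_div_one_sub : IsAcceleration (fun t : ℝ => t / (1 - t)) := by
  refine ⟨by simp, ?_, ?_, ?_, ?_⟩
  · -- strictly increasing on `[0,1)`
    intro a ha b hb hab
    have ha1 : 0 < 1 - a := by linarith [ha.2]
    have hb1 : 0 < 1 - b := by linarith [hb.2]
    rw [div_lt_div_iff₀ ha1 hb1]
    nlinarith [ha.1, hb.1]
  · -- `σ(t) → ∞` as `t ↑ 1`
    have h1 : Tendsto (fun t : ℝ => 1 - t) (𝓝[<] (1 : ℝ)) (𝓝[>] (0 : ℝ)) := by
      have hc : Tendsto (fun t : ℝ => 1 - t) (𝓝[<] (1 : ℝ)) (𝓝 (1 - 1)) :=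
        (tendsto_const_nhds.sub tendsto_id).mono_left nhdsWithin_le_nhds
      rw [sub_self] at hc
      refine tendsto_nhdsWithin_iff.2 ⟨hc, ?_⟩
      filter_upwards [self_mem_nhdsWithin] with t ht
      show 0 < 1 - t
      linarith [mem_Iio.1 ht]
    have h2 : Tendsto (fun t : ℝ => (1 - t)⁻¹) (𝓝[<] (1 : ℝ)) atTop :=
      tendsto_inv_nhdsGT_zero.comp h1
    have h3 : Tendsto (fun t : ℝ => t) (𝓝[<] (1 : ℝ)) (𝓝 1) :=
      tendsto_id.mono_left nhdsWithin_le_nhds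
    have h4 := Filter.Tendsto.pos_mul_atTop one_pos h3 h2
    refine h4.congr' ?_
    filter_upwards [self_mem_nhdsWithin] with t _
    simp [div_eq_mul_inv]
  · -- smooth on `[0,1)` (indeed on `{t ≠ 1}`)
    refine contDiffOn_id.div (contDiffOn_const.sub contDiffOn_id) fun t ht => ?_
    exact sub_ne_zero.2 (by linarith [ht.2] : (1 : ℝ) ≠ t)
  · -- positive one-sided derivative on `[0,1)`
    intro t ht
    have hne : t ≠ 1 := by linarith [ht.2]
    rw [(hasDerivAt_div_one_sub hne).hasDerivWithinAt.derivWithin (uniqueDiffOn_Ici 0 t ht.1)]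
    have : 0 < (1 - t) ^ 2 := by
      have : 0 < 1 - t := by linarith [ht.2]
      positivity
    positivity

end Rowan2024

end Literature.Analysis.FluidPDE

end
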